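import Literature.InformationTheory.QuantumCodes.HypergraphProductThresholds
import Literature.InformationTheory.QuantumCodes.SyndromeDecodingCSSPauli
import HarnessLib

/-!
# The planar surface codes: exact distances `d^X = d^Z = k + 2` and the optimal correction radius `⌊(k+1)/2⌋`

Topic `InformationTheory/QuantumCodes`; namespace `Literature.InformationTheory.QuantumCodes.PlanarCode`.
`HypergraphProductThresholds.lean` (qec-lit-2) constructs the `k`-th PLANAR surface code as the hypergraph product
`HGP(H, Hᵀ)` of the `(k+1) × (k+2)` repetition parity-check matrix `H` with its transpose (Tillich–Zémor §3): check
matrices `planarHX k`, `planarHZ k` on the `(k+2)² + (k+1)²` qubits `PlanarQubit k`, the distance LOWER bounds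
`≥ k + 2` of both sectors (`le_hammingNorm_of_planar_cycle`, `le_hammingNorm_of_planar_cocycle`, TZ Thm 9) and the two
logical strings `planarXString` / `planarZString` (TZ §3). This file packages the planar code as a check-matrix CSS code
(`PlanarCode.code k : CSSCode`, type-02's `CSSCode.ofMatrices`; commutation = TZ Prop. 3) and proves, for EVERY `k`:

* `hammingNorm_planarXString` / `hammingNorm_planarZString` — the strings have weight exactly `k + 2`;
* `code_dX` / `code_dZ` — **both sector distances are exactly `k + 2`** (= the linear size `L` of the patch; the familiar
  `[[L² + (L−1)², 1, L]]` surface code has `L = k + 2` here — the dimension is not restated in this file);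
* `minWeight_isCorrectionRadiusX` / `…Z` — EVERY minimum-weight sector decoder (e.g. minimum-weight perfect matching
  run to optimality) has correction radius EXACTLY `⌊(k+1)/2⌋` in its sector;
* `optimalRadiusX` / `optimalRadiusZ` — `⌊(k+1)/2⌋` is the OPTIMAL sector radius and it is attained: NO decoder of the
  sector — no function of the syndrome whatsoever — corrects every error of weight `⌊(k+1)/2⌋ + 1`
  (Gottesman §2.3 "to correct t errors … distance at least 2t+1"; Delfosse–Nickerson §3 "tight").

A FAMILY-level entry of the qec cell's Q4 «theorem column» (the toric family is `ToricCodeDistance.lean`). All PROVED,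
0 named facts, no `decide` on code data; axioms ⊆ {propext, Classical.choice, Quot.sound}. HONEST FRAMING: certified
statements about the code family as defined in the tree; nothing probabilistic (the planar thresholds are the cited file's
business); the attaining decoder is minimum-weight decoding as a specified function, not a benchmark of any implementation.

## References
* [TillichZemor2014] J.-P. Tillich, G. Zémor, IEEE Trans. IT 60 (2014) 1193, §3 (surface code = product of a repetition
  code with its transpose; its logical strings), Thm 9 (distance of the product).
* [DennisEtAl2002] Dennis–Kitaev–Landahl–Preskill, J. Math. Phys. 43 (2002) 4452 = arXiv:quant-ph/0110143, §3.2 Planar codes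
  (chunk p0009 L9: "A code with distance L is obtained from a square lattice, if the shortest paths from rough edge to rough edge,
  and from smooth edge to smooth edge, both contain L links. The lattice has L²+(L−1)² links").
* [Gottesman1997] D. Gottesman, PhD thesis, §2.3 (chunk p0014 L3).
* [DelfosseNickerson2021] N. Delfosse, N. H. Nickerson, Quantum 5 (2021) 595, §3 ¶2 (chunk p0006 L8–13).
-/

namespace Literature.InformationTheory.QuantumCodes

namespace PlanarCode

open Matrix

/-- **The `k`-th planar surface code as a check-matrix CSS code**: `H^X = planarHX k` (vertex checks),
`H^Z = planarHZ k` (chamber checks) on the qubits `PlanarQubit k`; commutation `H^X (H^Z)ᵀ = 0` is Tillich–Zémor's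
Prop. 3 for `HGP(H, Hᵀ)`. (definition) [cite: TillichZemor2014, §3 and Prop. 3 (the surface code as the product of a repetition code with its transpose)] -/
def code (k : ℕ) : CSSCode (PlanarCheck k) (PlanarZCheck k) (PlanarQubit k) :=
  CSSCode.ofMatrices (planarHX k) (planarHZ k)
    (by
      unfold planarHX planarHZ
      exact HypergraphProduct.xMatrix_mul_zMatrix_transpose _ _)

/-- `H^X` of the planar CSS code is `planarHX k` (definitional). [cite: TillichZemor2014, §3] -/
@[simp] theorem code_HX (k : ℕ) : (code k).HX = planarHX k := rfl

/-- `H^Z` of the planar CSS code is `planarHZ k` (definitional). [cite: TillichZemor2014, §3] -/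
@[simp] theorem code_HZ (k : ℕ) : (code k).HZ = planarHZ k := rfl

/-! ## The logical strings have weight exactly `k + 2` -/

/-- The vertical `X̄`-string consists of the `k + 2` edges `(α, 0)`. [cite: TillichZemor2014, §3 (logical operators of the surface code)] -/
theorem hammingNorm_planarXString (k : ℕ) : hammingNorm (planarXString k) = k + 2 := by
  classical
  have h : (Finset.univ.filter fun q : PlanarQubit k => planarXString k q ≠ 0) =
      Finset.univ.map ⟨fun α : Fin (k + 2) => (Sum.inl (α, 0) : PlanarQubit k),
        fun a b hab => by simpa using hab⟩ := by
    ext q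
    simp only [Finset.mem_filter, Finset.mem_univ, true_and, Finset.mem_map, Function.Embedding.coeFn_mk]
    rcases q with ⟨α, b⟩ | ⟨a, b⟩
    · simp only [planarXString, Sum.elim_inl, ne_eq, ite_eq_right_iff, one_ne_zero, imp_false, not_not,
        Sum.inl.injEq, Prod.mk.injEq]
      exact ⟨fun hb => ⟨α, rfl, hb.symm⟩, fun ⟨_, _, hb⟩ => hb.symm⟩
    · simp [planarXString]
  rw [hammingNorm, h, Finset.card_map, Finset.card_univ, Fintype.card_fin]

/-- The horizontal `Z̄`-string consists of the `k + 2` edges `(0, b)`. [cite: TillichZemor2014, §3 (logical operators of the surface code)] -/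
theorem hammingNorm_planarZString (k : ℕ) : hammingNorm (planarZString k) = k + 2 := by
  classical
  have h : (Finset.univ.filter fun q : PlanarQubit k => planarZString k q ≠ 0) =
      Finset.univ.map ⟨fun b : Fin (k + 2) => (Sum.inl (0, b) : PlanarQubit k),
        fun a b hab => by simpa using hab⟩ := by
    ext q
    simp only [Finset.mem_filter, Finset.mem_univ, true_and, Finset.mem_map, Function.Embedding.coeFn_mk]
    rcases q with ⟨α, b⟩ | ⟨a, b⟩
    · simp only [planarZString, Sum.elim_inl, ne_eq, ite_eq_right_iff, one_ne_zero, imp_false, not_not,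
        Sum.inl.injEq, Prod.mk.injEq]
      exact ⟨fun ha => ⟨b, ha.symm, rfl⟩, fun ⟨_, ha, _⟩ => ha.symm⟩
    · simp [planarZString]
  rw [hammingNorm, h, Finset.card_map, Finset.card_univ, Fintype.card_fin]

/-! ## Exact sector distances -/

/-- The planar code has an `X`-logical in the `CSSCode` sense (`H^Z z̄ = 0`, `z̄ ∉ rs H^X`): the horizontal string.
[cite: TillichZemor2014, §3 (logical operators of the surface code)] -/
theorem exists_xLogical (k : ℕ) :
    ∃ v : PlanarQubit k → ZMod 2, (code k).HZ *ᵥ v = 0 ∧ v ∉ (code k).rowSpX :=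
  ⟨planarZString k, (planarZString_logical k).1, (planarZString_logical k).2⟩

/-- The planar code has a `Z`-logical in the `CSSCode` sense (`H^X x̄ = 0`, `x̄ ∉ rs H^Z`): the vertical string.
[cite: TillichZemor2014, §3 (logical operators of the surface code)] -/
theorem exists_zLogical (k : ℕ) :
    ∃ v : PlanarQubit k → ZMod 2, (code k).HX *ᵥ v = 0 ∧ v ∉ (code k).rowSpZ :=
  ⟨planarXString k, (planarXString_logical k).1, (planarXString_logical k).2⟩

/-- **`d^X = k + 2` for the `k`-th planar surface code** (the minimum weight over `ker H^Z ∖ rs H^X`: upper bound by the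
horizontal string, lower bound = TZ Thm 9, cocycle half). [cite: TillichZemor2014, Thm 9] [cite: DennisEtAl2002, §3.2 (arXiv chunk p0009 L9: "A code with distance L is obtained from a square lattice … The lattice has L²+(L−1)² links")] -/
theorem code_dX (k : ℕ) : (code k).dX = k + 2 :=
  (code k).dX_eq_of_witness (v := planarZString k) (planarZString_logical k).1 (planarZString_logical k).2
    (hammingNorm_planarZString k) fun w hw hw' => le_hammingNorm_of_planar_cocycle k w hw hw'

/-- **`d^Z = k + 2` for the `k`-th planar surface code** (the minimum weight over `ker H^X ∖ rs H^Z`: upper bound by the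
vertical string, lower bound = TZ Thm 9, cycle half). [cite: TillichZemor2014, Thm 9] [cite: DennisEtAl2002, §3.2 (arXiv chunk p0009 L9: "A code with distance L is obtained from a square lattice … The lattice has L²+(L−1)² links")] -/
theorem code_dZ (k : ℕ) : (code k).dZ = k + 2 :=
  (code k).dZ_eq_of_witness (v := planarXString k) (planarXString_logical k).1 (planarXString_logical k).2
    (hammingNorm_planarXString k) fun w hw hw' => le_hammingNorm_of_planar_cycle k w hw hw'

/-! ## Decoding: the optimal correction radius of each sector is `⌊(k+1)/2⌋` -/

/-- **Every minimum-weight `X`-decoder of the `k`-th planar code (e.g. minimum-weight perfect matching run exactly) has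
correction radius EXACTLY `⌊(k+1)/2⌋`**: it corrects every bit-flip pattern of weight `≤ ⌊(k+1)/2⌋` and fails on some
pattern of weight `⌊(k+1)/2⌋ + 1`. [cite: DelfosseNickerson2021, §3 ¶2 (chunk p0006 L8–13: "up to (d−1)/2 … both of these bounds are tight")] -/
theorem minWeight_isCorrectionRadiusX (k : ℕ) {D : Decoder (PlanarZCheck k → ZMod 2) (PlanarQubit k → ZMod 2)}
    (hD : D.IsMinWeight (code k).xSyndrome ((code k).kerZ : Set (PlanarQubit k → ZMod 2)) hammingNorm) :
    D.IsCorrectionRadius (code k).xSyndrome ((code k).rowSpX : Set (PlanarQubit k → ZMod 2)) hammingNorm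
      ((k + 1) / 2) := by
  have h := (code k).isCorrectionRadiusX_of_isMinWeight hD (exists_xLogical k)
  have e : (k + 2 - 1) / 2 = (k + 1) / 2 := by omega
  rwa [code_dX, e] at h

/-- **Every minimum-weight `Z`-decoder of the `k`-th planar code has correction radius EXACTLY `⌊(k+1)/2⌋`.**
[cite: DelfosseNickerson2021, §3 ¶2 (chunk p0006 L8–13)] -/
theorem minWeight_isCorrectionRadiusZ (k : ℕ) {D : Decoder (PlanarCheck k → ZMod 2) (PlanarQubit k → ZMod 2)}
    (hD : D.IsMinWeight (code k).zSyndrome ((code k).kerX : Set (PlanarQubit k → ZMod 2)) hammingNorm) :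
    D.IsCorrectionRadius (code k).zSyndrome ((code k).rowSpZ : Set (PlanarQubit k → ZMod 2)) hammingNorm
      ((k + 1) / 2) := by
  have h := (code k).isCorrectionRadiusZ_of_isMinWeight hD (exists_zLogical k)
  have e : (k + 2 - 1) / 2 = (k + 1) / 2 := by omega
  rwa [code_dZ, e] at h

/-- **`⌊(k+1)/2⌋` is the optimal bit-flip correction radius of the `k`-th planar surface code, and it is attained**:
some decoder of the chamber syndrome (minimum-weight decoding) has correction radius exactly `⌊(k+1)/2⌋`, and NO
decoder — no function from syndromes to corrections whatsoever — corrects every bit-flip pattern of weight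
`⌊(k+1)/2⌋ + 1`. [cite: Gottesman1997, §2.3 (chunk p0014 L3: "to correct up to t errors must have distance at least 2t+1")] [cite: DelfosseNickerson2021, §3 ¶2 (chunk p0006 L8–13)] -/
theorem optimalRadiusX (k : ℕ) :
    (∃ D : Decoder (PlanarZCheck k → ZMod 2) (PlanarQubit k → ZMod 2),
        D.IsCorrectionRadius (code k).xSyndrome ((code k).rowSpX : Set (PlanarQubit k → ZMod 2)) hammingNorm
          ((k + 1) / 2)) ∧
      ∀ (D : Decoder (PlanarZCheck k → ZMod 2) (PlanarQubit k → ZMod 2)) (t : ℕ),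
        D.CorrectsUpTo (code k).xSyndrome ((code k).rowSpX : Set (PlanarQubit k → ZMod 2)) hammingNorm t →
          t ≤ (k + 1) / 2 := by
  have h := (code k).optimalRadiusX (exists_xLogical k)
  have e : (k + 2 - 1) / 2 = (k + 1) / 2 := by omega
  rwa [code_dX, e] at h

/-- **`⌊(k+1)/2⌋ is the optimal phase-flip correction radius of the `k`-th planar surface code, and it is attained.**
[cite: Gottesman1997, §2.3 (chunk p0014 L3)] [cite: DelfosseNickerson2021, §3 ¶2 (chunk p0006 L8–13)] -/
theorem optimalRadiusZ (k : ℕ) :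
    (∃ D : Decoder (PlanarCheck k → ZMod 2) (PlanarQubit k → ZMod 2),
        D.IsCorrectionRadius (code k).zSyndrome ((code k).rowSpZ : Set (PlanarQubit k → ZMod 2)) hammingNorm
          ((k + 1) / 2)) ∧
      ∀ (D : Decoder (PlanarCheck k → ZMod 2) (PlanarQubit k → ZMod 2)) (t : ℕ),
        D.CorrectsUpTo (code k).zSyndrome ((code k).rowSpZ : Set (PlanarQubit k → ZMod 2)) hammingNorm t →
          t ≤ (k + 1) / 2 := by
  have h := (code k).optimalRadiusZ (exists_zLogical k)
  have e : (k + 2 - 1) / 2 = (k + 1) / 2 := by omega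
  rwa [code_dZ, e] at h

end PlanarCode

end Literature.InformationTheory.QuantumCodes
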